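import Summits.ValiantsHypothesis.ValiantsHypothesis.Theses.ForgivenCollisions

/-!
# The syndrome representative of the permanent modulo the collision ideal

Route `ForgivenCollisions`, support item `SyndromeRepresentative`
(stmt-ValiantsHypothesis-11569).

For an abelian group `G` and a labelling `g : Fin n → G` that separates disjoint equal-size
subsets of size `1 … r-1` (`∑_A g ≠ ∑_B g`), the 0/1 polynomial
`f_g = ∑_{j : Fin n → Fin n, ∑ i, g (j i) = ∑ c, g c} ∏ i, X (i, j i)`
agrees with `per_n` modulo the collision ideal `J_r(n)` spanned by the monomials with a tripled
line or at least `r` doubled lines.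

Proof: bijective `j` always pass the syndrome test and give exactly the permutation monomials of
`per_n`; a non-bijective `j` passing the test has a column of multiplicity `≥ 3` or `q` doubled and
`q` empty columns with `∑_doubled g = ∑_empty g`, which the separation hypothesis forbids for
`1 ≤ q ≤ r - 1`; hence `q ≥ r` and the monomial lies in `J_r(n)`.
-/

noncomputable section

-- `Summit.ValiantsHypothesis.ValiantsHypothesis.…` is the tree's mandated single-conjunct layout (Sub = Summit).
set_option linter.dupNamespace false

namespace Summit.ValiantsHypothesis.ValiantsHypothesis.Theorems

open MvPolynomial Finset Literature.Computability.AlgebraicComplexity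

namespace ForgivenCollisionsSyndromeRepresentative

/-- The exponent vector `∑ i, e_{(i, j i)}` of the map monomial `∏ i, X (i, j i)` takes the value
`[j a = b]` at `(a, b)`. -/
theorem mapMonomial_apply {n : ℕ} (j : Fin n → Fin n) (a b : Fin n) :
    (∑ i : Fin n, Finsupp.single (i, j i) (1 : ℕ)) (a, b) = if j a = b then 1 else 0 := by
  simp only [Finsupp.coe_finsetSum, Finset.sum_apply, Finsupp.single_apply, Prod.mk.injEq]
  rw [Finset.sum_eq_single a]
  · simp
  · intro i _ hia
    simp [hia]
  · simp

/-- A map monomial takes exactly one variable from each row. -/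
theorem rowCount_mapMonomial {n : ℕ} (j : Fin n → Fin n) (a : Fin n) :
    rowCount (∑ i : Fin n, Finsupp.single (i, j i) (1 : ℕ)) a = 1 := by
  simp only [rowCount, mapMonomial_apply]
  rw [Finset.sum_ite_eq]
  simp

/-- A map monomial takes `#j⁻¹(b)` variables from column `b`. -/
theorem colCount_mapMonomial {n : ℕ} (j : Fin n → Fin n) (b : Fin n) :
    colCount (∑ i : Fin n, Finsupp.single (i, j i) (1 : ℕ)) b = #{a | j a = b} := by
  simp only [colCount, mapMonomial_apply]
  rw [Finset.sum_boole]
  simp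

/-- The map monomial as a monomial. -/
theorem prod_X_eq_monomial {n : ℕ} (j : Fin n → Fin n) :
    ∏ i : Fin n, (X (i, j i) : MvPolynomial (Fin n × Fin n) ℂ) =
      monomial (∑ i : Fin n, Finsupp.single (i, j i) (1 : ℕ)) 1 := by
  rw [monomial_sum_one]
  rfl

/-- The permanent is the sum of the map monomials over the bijective maps. -/
theorem perPoly_eq_sum_bijective (n : ℕ) :
    perPoly (Fin n) ℂ = ∑ j ∈ (univ : Finset (Fin n → Fin n)).filter
      (fun j => Function.Bijective j), ∏ i : Fin n, (X (i, j i) : MvPolynomial (Fin n × Fin n) ℂ) := by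
  unfold perPoly
  rw [← Matrix.permanent_transpose]
  unfold Matrix.permanent
  refine Finset.sum_nbij (fun σ => ⇑σ) ?_ ?_ ?_ ?_
  · intro σ _
    exact Finset.mem_filter.2 ⟨Finset.mem_univ _, σ.bijective⟩
  · exact fun σ _ τ _ h => Equiv.coe_fn_injective h
  · intro j hj
    have hj' : Function.Bijective j := (Finset.mem_filter.1 (Finset.mem_coe.1 hj)).2
    exact ⟨Equiv.ofBijective j hj', Finset.mem_coe.2 (Finset.mem_univ _), rfl⟩
  · intro σ _
    simp [Matrix.transpose_apply, Matrix.mvPolynomialX_apply]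

/-- Core counting step (the "syndrome shift"): a non-bijective map `j` whose columns all have
multiplicity `≤ 2` and which passes the syndrome test has at least `r` doubled columns. -/
theorem syndrome_shift {n r : ℕ} {G : Type*} [AddCommGroup G] (g : Fin n → G)
    (hg : ∀ A B : Finset (Fin n), Disjoint A B → A.card = B.card → 1 ≤ A.card → A.card + 1 ≤ r →
      ∑ t ∈ A, g t ≠ ∑ t ∈ B, g t)
    (j : Fin n → Fin n) (hj : ¬ Function.Bijective j) (hsyn : ∑ i, g (j i) = ∑ c, g c)
    (h3 : ∀ c : Fin n, #{a | j a = c} < 3) : r ≤ #{c | 2 ≤ #{a | j a = c}} := by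
  by_contra hr
  push Not at hr
  set A : Finset (Fin n) := univ.filter fun c => 2 ≤ #{a | j a = c} with hA
  set B : Finset (Fin n) := univ.filter fun c => #{a | j a = c} = 0 with hB
  have hsumk : ∑ c, #{a | j a = c} = n := by
    have := Finset.card_eq_sum_card_fiberwise (s := (univ : Finset (Fin n))) (t := univ) (f := j)
      (fun _ _ => mem_univ _)
    simpa using this.symm
  have hsyn' : ∑ c, #{a | j a = c} • g c = ∑ c, g c := by
    rw [← hsyn, ← Finset.sum_fiberwise' univ j g]
    refine Finset.sum_congr rfl fun c _ => ?_
    rw [Finset.sum_const]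
  have hpt : ∀ c, ((#{a | j a = c} : ℤ) - 1) =
      (if 2 ≤ #{a | j a = c} then 1 else 0) - (if #{a | j a = c} = 0 then 1 else 0) := by
    intro c
    have := h3 c
    split_ifs <;> omega
  have hcard : (#A : ℤ) = #B := by
    have h1 : ∑ c, ((#{a | j a = c} : ℤ) - 1) = 0 := by
      rw [Finset.sum_sub_distrib]
      simp [← Nat.cast_sum, hsumk]
    rw [Finset.sum_congr rfl (fun c _ => hpt c), Finset.sum_sub_distrib, Finset.sum_boole,
      Finset.sum_boole] at h1
    exact sub_eq_zero.mp h1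
  have hAB : ∑ t ∈ A, g t = ∑ t ∈ B, g t := by
    have h1 : ∑ c, ((#{a | j a = c} : ℤ) - 1) • g c = 0 := by
      simp_rw [sub_smul, one_smul, natCast_zsmul]
      rw [Finset.sum_sub_distrib, hsyn', sub_self]
    simp_rw [hpt, sub_smul, ite_smul, one_smul, zero_smul] at h1
    rw [Finset.sum_sub_distrib, ← Finset.sum_filter, ← Finset.sum_filter] at h1
    exact sub_eq_zero.mp h1
  have hdisj : Disjoint A B := by
    rw [hA, hB, Finset.disjoint_filter]
    intro c _ h2 h0
    omega
  have hBne : B.Nonempty := by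
    have hs : ¬ Function.Surjective j := fun hs => hj (Finite.surjective_iff_bijective.mp hs)
    simp only [Function.Surjective, not_forall, not_exists] at hs
    obtain ⟨c, hc⟩ := hs
    refine ⟨c, ?_⟩
    simp only [hB, Finset.mem_filter, Finset.mem_univ, true_and, Finset.card_eq_zero,
      Finset.filter_eq_empty_iff]
    exact fun a _ => hc a
  have hcard' : #A = #B := by exact_mod_cast hcard
  have hA1 : 1 ≤ #A := by
    rw [hcard']
    exact hBne.card_pos
  exact hg A B hdisj hcard' hA1 (by omega) hAB

end ForgivenCollisionsSyndromeRepresentative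

open ForgivenCollisionsSyndromeRepresentative in
/-- **Syndrome lemma** (route ForgivenCollisions, item `SyndromeRepresentative`): for a
`B_{r-1}`-separated labelling `g : Fin n → G`, the syndrome polynomial
`∑_{j : ∑ i, g (j i) = ∑ c, g c} ∏ i, X (i, j i)` is congruent to `per_n` modulo the collision
ideal `J_r(n)`. -/
theorem syndromeRepresentative_proof :
    Summit.ValiantsHypothesis.ValiantsHypothesis.Theses.ForgivenCollisions.SyndromeRepresentative := by
  unfold Summit.ValiantsHypothesis.ValiantsHypothesis.Theses.ForgivenCollisions.SyndromeRepresentative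
  intro n r G _ g hg
  -- we prove the claim for any finset `S` of maps with the right membership predicate, so that
  -- the decidability instance hidden in the statement's `filter` plays no role
  suffices key : ∀ S : Finset (Fin n → Fin n), (∀ j, j ∈ S ↔ ∑ i, g (j i) = ∑ c, g c) →
      (∑ j ∈ S, ∏ i : Fin n, (X (i, j i) : MvPolynomial (Fin n × Fin n) ℂ)) -
        perPoly (Fin n) ℂ ∈ Ideal.span ((fun d : Fin n × Fin n →₀ ℕ => monomial d (1 : ℂ)) ''
          {d | ((∃ i : Fin n, 3 ≤ rowCount d i) ∨ (∃ j : Fin n, 3 ≤ colCount d j) ∨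
            r ≤ (univ.filter fun i : Fin n => 2 ≤ rowCount d i).card +
              (univ.filter fun j : Fin n => 2 ≤ colCount d j).card)}) by
    exact key _ fun j => by simp
  intro S hS
  -- bijective maps pass the syndrome test and give exactly the permanent
  have hsub : univ.filter (fun j : Fin n → Fin n => Function.Bijective j) ⊆ S := by
    intro j hj
    simp only [Finset.mem_filter, Finset.mem_univ, true_and] at hj
    exact (hS j).2 (Equiv.sum_comp (Equiv.ofBijective j hj) g)
  rw [perPoly_eq_sum_bijective n, ← Finset.sum_sdiff hsub, add_sub_cancel_right]
  -- each remaining monomial lies in the collision ideal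
  refine Ideal.sum_mem _ fun j hj => ?_
  rw [Finset.mem_sdiff] at hj
  obtain ⟨hjS, hbij⟩ := hj
  have hsyn : ∑ i, g (j i) = ∑ c, g c := (hS j).1 hjS
  replace hbij : ¬ Function.Bijective j := fun h =>
    hbij (Finset.mem_filter.2 ⟨Finset.mem_univ _, h⟩)
  rw [prod_X_eq_monomial]
  refine Ideal.subset_span ⟨_, ?_, rfl⟩
  simp only [Set.mem_setOf_eq]
  by_cases h3 : ∃ c : Fin n, 3 ≤ colCount (∑ i : Fin n, Finsupp.single (i, j i) (1 : ℕ)) c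
  · exact Or.inr (Or.inl h3)
  · push Not at h3
    simp only [colCount_mapMonomial] at h3
    have key := syndrome_shift g hg j hbij hsyn h3
    refine Or.inr (Or.inr ?_)
    simp only [rowCount_mapMonomial, colCount_mapMonomial]
    omega

end Summit.ValiantsHypothesis.ValiantsHypothesis.Theorems
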